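import Literature.Computability.MetaComplexity.EFDerives
import Literature.Computability.MetaComplexity.EFRuleCheck
import HarnessLib

/-!
# Layouts of netlist pieces, occurrences, and multiplexer naturality

Infrastructure for the extended Frege proof-construction kit (`EFNetlist.lean`,
`EFDerives.lean`). The auxiliary circuits of an arithmetic law (intermediate products,
comparators, …) are allocated as ONE template obtained by appending *pieces* — embedded copies
(`Netlist.embed`) of smaller templates whose inputs are wired to the inputs of the whole or to
earlier gates. This file provides the generic bookkeeping: the layout of a family of pieces
(`Netlist.layout`), its length, the position and shape of every embedded gate
(`Netlist.getElem_layout`), well-formedness (`Netlist.wf_layout`) and the availability of the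
definitions of every piece as a sub-instance (`Netlist.Inst.DefsAvail.piece`), phrased through
*occurrences* (`Netlist.Occ`: base of the gate variables and the input variables as a function,
the form in which laws are stated so that they apply verbatim to embedded copies).

The second part is the **multiplexer naturality block**: if the inputs of an instance `o` of a
template are, bit by bit, multiplexers `g ? aᵢ : aᵢ'` of the inputs of two further instances
`o₁, o₂` of the same template, then every wire of `o` is provably the multiplexer of the
corresponding wires of `o₁` and `o₂` (one sound rule per gate kind, `Netlist.muxNatRules`),
together with the small rules drawing conclusions from such multiplexer relations.

## Sources

* H. Vollmer, *Introduction to Circuit Complexity* (Springer 1999), §1.2, Def. 1.6–1.7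
  (composition of circuits as straight-line programs).
* S. A. Cook, R. A. Reckhow, *The relative efficiency of propositional proof systems*,
  J. Symbolic Logic 44 (1979), §2 (sound schematic rules), Def. 4.1 (extension).
-/

namespace Literature.Computability.MetaComplexity

open _root_.Computability Complexity Complexity.PropForm FregeSystem

namespace Netlist

/-! ### Pieces and layouts -/

/-- A piece of a layout: a template with `nIn` inputs and the wiring of its inputs — to an input
of the whole layout (`Sum.inl a`) or to an (absolute) earlier gate of the layout (`Sum.inr g`).
[cite: Vollmer1999, Def. 1.6] -/
structure Piece where
  /-- the embedded template -/
  T : Template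
  /-- its number of inputs -/
  nIn : ℕ
  /-- the wiring of its inputs -/
  wire : ℕ → ℕ ⊕ ℕ

/-- **The layout of the first `N` pieces** of a family: the pieces embedded one after the other,
piece `k` at offset `(layout P k).length`. [cite: Vollmer1999, §1.2 (composition)] -/
def layout (P : ℕ → Piece) : ℕ → Template
  | 0 => []
  | N + 1 => layout P N ++ embed (P N).T (P N).wire (layout P N).length

/-- The offset of piece `k`: the number of gates of the earlier pieces. [folklore] -/
def offset (P : ℕ → Piece) (k : ℕ) : ℕ := (layout P k).length

/-- The length of a layout is the offset of the next piece. [folklore] -/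
@[simp] theorem length_layout (P : ℕ → Piece) (N : ℕ) : (layout P N).length = offset P N := rfl

/-- Unfolding a layout. [folklore] -/
theorem layout_succ (P : ℕ → Piece) (N : ℕ) :
    layout P (N + 1) = layout P N ++ embed (P N).T (P N).wire (offset P N) := rfl

/-- The empty layout has offset `0`. [folklore] -/
@[simp] theorem offset_zero (P : ℕ → Piece) : offset P 0 = 0 := rfl

/-- Offsets: the next offset adds the length of the piece. [folklore] -/
theorem offset_succ (P : ℕ → Piece) (N : ℕ) : offset P (N + 1) = offset P N + (P N).T.length := by
  rw [offset, layout_succ, List.length_append, length_embed, length_layout]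

/-- Offsets are monotone. [folklore] -/
theorem offset_le_of_le (P : ℕ → Piece) {k N : ℕ} (h : k ≤ N) : offset P k ≤ offset P N := by
  induction N with
  | zero => rw [Nat.le_zero.1 h]
  | succ N ih =>
    rcases Nat.lt_succ_iff_lt_or_eq.1 (Nat.lt_succ_of_le h) with h' | rfl
    · exact (ih (Nat.lt_succ_iff.1 h')).trans (by rw [offset_succ]; omega)
    · exact le_rfl

/-- The gates of piece `k` end before the offset of any later piece. [folklore] -/
theorem offset_add_lt_offset (P : ℕ → Piece) {k N j : ℕ} (hk : k < N) (hj : j < (P k).T.length) :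
    offset P k + j < offset P N := by
  have := offset_le_of_le P (Nat.succ_le_of_lt hk)
  rw [offset_succ] at this
  omega

/-- A layout extends its prefixes. [folklore] -/
theorem layout_prefix (P : ℕ → Piece) {k N : ℕ} (h : k ≤ N) : ∃ rest : Template, layout P N = layout P k ++ rest := by
  induction N with
  | zero =>
    rw [Nat.le_zero.1 h]
    exact ⟨[], by simp⟩
  | succ N ih =>
    rcases Nat.lt_succ_iff_lt_or_eq.1 (Nat.lt_succ_of_le h) with h' | rfl
    · obtain ⟨rest, hrest⟩ := ih (Nat.lt_succ_iff.1 h')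
      exact ⟨rest ++ embed (P N).T (P N).wire (offset P N), by rw [layout_succ, hrest, List.append_assoc]⟩
    · exact ⟨[], by simp⟩

/-- **The gates of a layout**: gate `j` of piece `k < N` sits at position `offset P k + j` and is
the embedded gate (same kind, arguments re-wired through `(P k).wire` and shifted by the offset).
[cite: Vollmer1999, §1.2] -/
theorem getElem_layout (P : ℕ → Piece) {k N j : ℕ} (hk : k < N) (hj : j < (P k).T.length) :
    ∃ h : offset P k + j < (layout P N).length, (layout P N)[offset P k + j] =
      ⟨((P k).T[j]).kind, ((P k).T[j]).args.map (remap (P k).wire (offset P k))⟩ := by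
  obtain ⟨rest, hrest⟩ := layout_prefix P (Nat.succ_le_of_lt hk)
  refine ⟨by simpa using offset_add_lt_offset P hk hj, ?_⟩
  simp only [hrest, layout_succ, List.append_assoc]
  rw [List.getElem_append_right (by simp)]
  simp only [length_layout, Nat.add_sub_cancel_left]
  rw [List.getElem_append_left (by simpa using hj)]
  simp [embed]

/-- `Piece.OK P nIn k`: piece `k` is well formed and wired to inputs `< nIn` of the whole or to
gates of earlier pieces. [cite: Vollmer1999, Def. 1.6] -/
def Piece.OK (P : ℕ → Piece) (nIn k : ℕ) : Prop :=
  (P k).T.WF (P k).nIn ∧ ∀ i < (P k).nIn,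
    (∀ a, (P k).wire i = Sum.inl a → a < nIn) ∧ (∀ g, (P k).wire i = Sum.inr g → g < offset P k)

/-- **A layout of well-formed, well-wired pieces is well formed.** [cite: Vollmer1999, Def. 1.6] -/
theorem wf_layout (P : ℕ → Piece) {nIn : ℕ} : ∀ {N : ℕ}, (∀ k < N, Piece.OK P nIn k) → (layout P N).WF nIn
  | 0, _ => fun k hk => absurd hk (Nat.not_lt_zero k)
  | N + 1, h => by
    intro k hk
    have hN := h N (Nat.lt_succ_self N)
    have hk' : k < offset P N + (P N).T.length := by rwa [length_layout, offset_succ] at hk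
    by_cases hkN : k < offset P N
    · have hwf := wf_layout P (fun k hk => h k (Nat.lt_succ_of_lt hk)) k hkN
      simp only [layout_succ, List.getElem_append_left (hkN.trans_eq (length_layout P N).symm)]
      exact hwf
    · obtain ⟨j, rfl⟩ : ∃ j, k = offset P N + j := ⟨k - offset P N, by omega⟩
      have hj : j < (P N).T.length := by omega
      obtain ⟨_, heq⟩ := getElem_layout P (Nat.lt_succ_self N) hj
      rw [heq]
      exact wf_embed_gate hN.1 hN.2 hj

/-! ### Occurrences -/

/-- An occurrence of a template inside a proof: the base of its gate variables and its input
variables by input index (a view, cf. `Adder.View`; the instance `Occ.inst`). [folklore] -/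
structure Occ where
  /-- the first gate variable -/
  base : ℕ
  /-- the input variables, by input index -/
  inp : ℕ → ℕ

/-- The instance of an occurrence with `nIn` inputs. [folklore] -/
def Occ.inst (o : Occ) (nIn : ℕ) : Inst := ⟨(List.range nIn).map o.inp, o.base⟩

/-- The variable of gate `k` of an occurrence. [folklore] -/
def Occ.wire (o : Occ) (k : ℕ) : ℕ := o.base + k

/-- Availability of the definitions of an occurrence of `t` (with `nIn` inputs). [folklore] -/
def Occ.Avail (o : Occ) (t : Template) (nIn : ℕ) (K : PropForm ℕ) (Γ : Set (PropForm ℕ)) : Prop :=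
  (o.inst nIn).DefsAvail t K Γ

/-- The wires of the instance of an occurrence. [folklore] -/
@[simp] theorem Occ.wire_inst (o : Occ) (nIn k : ℕ) : (o.inst nIn).wire k = o.wire k := rfl

/-- The base of the instance of an occurrence. [folklore] -/
@[simp] theorem Occ.base_inst (o : Occ) (nIn : ℕ) : (o.inst nIn).base = o.base := rfl

/-- The inputs of the instance of an occurrence. [folklore] -/
theorem Occ.getD_inst (o : Occ) {nIn i : ℕ} (hi : i < nIn) : (o.inst nIn).inputs.getD i 0 = o.inp i := by
  simp [Occ.inst, List.getD_eq_getElem?_getD, hi]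

/-- Input references of the instance of an occurrence. [folklore] -/
theorem Occ.ref_inl (o : Occ) {nIn i : ℕ} (hi : i < nIn) : (o.inst nIn).ref (Sum.inl i) = o.inp i :=
  o.getD_inst hi

/-- Gate references of the instance of an occurrence. [folklore] -/
@[simp] theorem Occ.ref_inr (o : Occ) (nIn j : ℕ) : (o.inst nIn).ref (Sum.inr j) = o.wire j := rfl

/-- Availability of an occurrence is monotone. [folklore] -/
theorem Occ.Avail.mono {o : Occ} {t : Template} {nIn : ℕ} {K : PropForm ℕ} {Γ Γ' : Set (PropForm ℕ)}
    (h : o.Avail t nIn K Γ) (hΓ : Γ ⊆ Γ') : o.Avail t nIn K Γ' := Inst.DefsAvail.mono h hΓ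

/-- **The occurrence of piece `k`** inside an instance `I` of a layout: base `I.base + offset`,
inputs read through the wiring. [folklore] -/
def pieceOcc (I : Inst) (P : ℕ → Piece) (k : ℕ) : Occ := ⟨I.base + offset P k, fun i => I.ref ((P k).wire i)⟩

/-- The instance of the occurrence of a piece is the sub-instance of the kit. [folklore] -/
theorem pieceOcc_inst (I : Inst) (P : ℕ → Piece) (k : ℕ) :
    (pieceOcc I P k).inst (P k).nIn = I.subInst (P k).wire (offset P k) (P k).nIn := rfl

/-- **The definitions of every piece of an available layout are available.** [folklore] -/
theorem Inst.DefsAvail.piece {I : Inst} {P : ℕ → Piece} {N : ℕ} {K : PropForm ℕ} {Γ : Set (PropForm ℕ)}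
    (h : I.DefsAvail (layout P N) K Γ) {k : ℕ} (hk : k < N) (hwf : (P k).T.WF (P k).nIn) :
    (pieceOcc I P k).Avail (P k).T (P k).nIn K Γ := by
  rw [Occ.Avail, pieceOcc_inst]
  exact h.subInst hwf fun j hj => getElem_layout P hk hj

/-- The wires of the occurrence of a piece are wires of the whole instance. [folklore] -/
@[simp] theorem wire_pieceOcc (I : Inst) (P : ℕ → Piece) (k j : ℕ) :
    (pieceOcc I P k).wire j = I.wire (offset P k + j) := by
  simp [pieceOcc, Occ.wire, Inst.wire, Nat.add_assoc]

/-- The inputs of the occurrence of a piece. [folklore] -/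
@[simp] theorem inp_pieceOcc (I : Inst) (P : ℕ → Piece) (k i : ℕ) :
    (pieceOcc I P k).inp i = I.ref ((P k).wire i) := rfl

/-! ### Gate-indexed derivations -/

/-- **A gate-indexed derivation**: lines `line 0, …, line (n-1)`, each available or inferred from
`Γ` and the earlier lines, are derived in size `n · c`. [folklore] -/
theorem _root_.Literature.Computability.MetaComplexity.FregeSystem.Yields.indexed {G : FregeSystem}
    {Γ : Set (PropForm ℕ)} {line : ℕ → PropForm ℕ} {n c : ℕ}
    (h : ∀ k < n, line k ∈ Γ ∨ G.IsInferredFrom (Γ ∪ {χ | ∃ j < k, χ = line j}) (line k))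
    (hc : ∀ k < n, (line k).size ≤ c) : G.Yields Γ {θ | ∃ k < n, θ = line k} (n * c) := by
  refine Yields.of_isBlock (isBlock_map_range n h) ?_ (proofSize_map_range_le hc)
  rintro θ ⟨k, hk, rfl⟩
  exact mem_map_range hk

/-! ### Multiplexer naturality -/

/-- The multiplexer relation `w ↔ (g ? w₁ : w₂)` between three bits. [folklore] -/
def muxRel (g w w₁ w₂ : ℕ) : PropForm ℕ := biimp (var w) (muxF (var g) (var w₁) (var w₂))

/-- Size of a multiplexer relation. [folklore] -/
@[simp] theorem size_muxRel (g w w₁ w₂ : ℕ) : (muxRel g w w₁ w₂).size = 23 := by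
  simp [muxRel, muxF, FregeSystem.size_biimp, size]

/-- The **naturality rule** for gates of kind `k` (arity `ar`): if the arguments of a gate `w`
are multiplexers `g ? yᵢ : zᵢ` of the arguments of two gates `w₁, w₂` of the same kind, then
`w ↔ (g ? w₁ : w₂)`. Metavariables: context `0`, selector `1`, `yᵢ = 2,3,4`, `zᵢ = 5,6,7`,
`xᵢ = 8,9,10` (the multiplexed arguments), `w₁ = 11`, `w₂ = 12`, `w = 13`.
[cite: CookReckhow1979, §2 (sound rule)] -/
def rMuxNat (k : Kind) (ar : ℕ) : FregeRule :=
  ⟨ctx (var 0) (biimp (var 13) (k.body [var 8, var 9, var 10])) ::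
    ctx (var 0) (biimp (var 11) (k.body [var 2, var 3, var 4])) ::
    ctx (var 0) (biimp (var 12) (k.body [var 5, var 6, var 7])) ::
    (List.range ar).map (fun i => ctx (var 0) (muxRel 1 (8 + i) (2 + i) (5 + i))),
   ctx (var 0) (muxRel 1 13 11 12)⟩

/-- Both data inputs equal to `c` give output `c`: `w ↔ (g ? w₁ : w₂), w₁ ↔ c, w₂ ↔ c ⊢ w ↔ c`.
[cite: CookReckhow1979, §2 (sound rule)] -/
def rMuxRelBoth : FregeRule :=
  ⟨[ctx (var 0) (muxRel 2 1 3 4), ctx (var 0) (eqv 3 5), ctx (var 0) (eqv 4 5)], ctx (var 0) (eqv 1 5)⟩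

/-- Both data inputs false give a false output. [cite: CookReckhow1979, §2 (sound rule)] -/
def rMuxRelFF : FregeRule :=
  ⟨[ctx (var 0) (muxRel 2 1 3 4), ctx (var 0) (neg (var 3)), ctx (var 0) (neg (var 4))], ctx (var 0) (neg (var 1))⟩

/-- Both data inputs true give a true output. [cite: CookReckhow1979, §2 (sound rule)] -/
def rMuxRelTT : FregeRule :=
  ⟨[ctx (var 0) (muxRel 2 1 3 4), ctx (var 0) (var 3), ctx (var 0) (var 4)], ctx (var 0) (var 1)⟩

/-- The rules of the naturality layer. [cite: CookReckhow1979, §2] -/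
def muxNatRules : List FregeRule :=
  [rMuxNat (Kind.cst false) 0, rMuxNat (Kind.cst true) 0, rMuxNat Kind.not 1, rMuxNat Kind.and 2,
    rMuxNat Kind.or 2, rMuxNat Kind.xor3 3, rMuxNat Kind.maj 3, rMuxNat Kind.mux 3,
    rMuxRelBoth, rMuxRelFF, rMuxRelTT]

/-- The definition list of `rMuxNat k ar` for the checker `FregeRule.checkD`. [folklore] -/
def dsMuxNat (k : Kind) (ar : ℕ) : List (ℕ × PropForm ℕ) :=
  (List.range ar).map (fun i => (8 + i, muxF (var 1) (var (2 + i)) (var (5 + i)))) ++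
    [(11, k.body [var 2, var 3, var 4]), (12, k.body [var 5, var 6, var 7]), (13, k.body [var 8, var 9, var 10])]

/-- Soundness checks of the naturality rules (definitional extension over 8 free metavariables).
[cite: CookReckhow1979, §2 (sound rule)] -/
theorem checkD_rMuxNat :
    (rMuxNat (Kind.cst false) 0).checkD 8 (dsMuxNat (Kind.cst false) 0) = true ∧
    (rMuxNat (Kind.cst true) 0).checkD 8 (dsMuxNat (Kind.cst true) 0) = true ∧
    (rMuxNat Kind.not 1).checkD 8 (dsMuxNat Kind.not 1) = true ∧
    (rMuxNat Kind.and 2).checkD 8 (dsMuxNat Kind.and 2) = true ∧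
    (rMuxNat Kind.or 2).checkD 8 (dsMuxNat Kind.or 2) = true ∧
    (rMuxNat Kind.xor3 3).checkD 8 (dsMuxNat Kind.xor3 3) = true ∧
    (rMuxNat Kind.maj 3).checkD 8 (dsMuxNat Kind.maj 3) = true ∧
    (rMuxNat Kind.mux 3).checkD 8 (dsMuxNat Kind.mux 3) = true := by
  refine ⟨?_, ?_, ?_, ?_, ?_, ?_, ?_, ?_⟩ <;> decide +kernel

/-- Every rule of the naturality layer is sound. [cite: CookReckhow1979, §2 (sound rule)] -/
theorem isSound_of_mem_muxNatRules : ∀ r ∈ muxNatRules, r.IsSound := by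
  obtain ⟨h₁, h₂, h₃, h₄, h₅, h₆, h₇, h₈⟩ := checkD_rMuxNat
  intro r hr
  simp only [muxNatRules, List.mem_cons, List.not_mem_nil, or_false] at hr
  rcases hr with rfl | rfl | rfl | rfl | rfl | rfl | rfl | rfl | rfl | rfl | rfl
  · exact FregeRule.isSound_of_checkD h₁
  · exact FregeRule.isSound_of_checkD h₂
  · exact FregeRule.isSound_of_checkD h₃
  · exact FregeRule.isSound_of_checkD h₄
  · exact FregeRule.isSound_of_checkD h₅
  · exact FregeRule.isSound_of_checkD h₆
  · exact FregeRule.isSound_of_checkD h₇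
  · exact FregeRule.isSound_of_checkD h₈
  · exact FregeRule.isSound_of_check (by decide +kernel)
  · exact FregeRule.isSound_of_check (by decide +kernel)
  · exact FregeRule.isSound_of_check (by decide +kernel)

/-- The naturality rule of a kind is in the layer. [folklore] -/
theorem rMuxNat_mem (k : Kind) : rMuxNat k k.arity ∈ muxNatRules := by
  rcases k with (_ | _) | _ | _ | _ | _ | _ | _ <;> simp [muxNatRules, Kind.arity]

/-- Membership of the small rules. [folklore] -/
theorem mem_muxNatRules : rMuxRelBoth ∈ muxNatRules ∧ rMuxRelFF ∈ muxNatRules ∧ rMuxRelTT ∈ muxNatRules := by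
  simp [muxNatRules]

variable {G : FregeSystem} {Γ : Set (PropForm ℕ)}

/-- One naturality inference at gate `n`: from the three definitions of the gate (in `o`, `o₁`,
`o₂`) and the multiplexer relations of its arguments. [cite: CookReckhow1979, §2] -/
theorem isInferredFrom_muxNat (hG : ∀ r ∈ muxNatRules, r ∈ G.rules) {S : Set (PropForm ℕ)} (I I₁ I₂ : Inst)
    (K : PropForm ℕ) (g n : ℕ) (kd : Kind) (args : List (ℕ ⊕ ℕ)) (hlen : args.length = kd.arity)
    (hd : ctx K (biimp (var (I.wire n)) (I.body ⟨kd, args⟩)) ∈ S)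
    (hd₁ : ctx K (biimp (var (I₁.wire n)) (I₁.body ⟨kd, args⟩)) ∈ S)
    (hd₂ : ctx K (biimp (var (I₂.wire n)) (I₂.body ⟨kd, args⟩)) ∈ S)
    (hargs : ∀ a ∈ args, ctx K (muxRel g (I.ref a) (I₁.ref a) (I₂.ref a)) ∈ S) :
    G.IsInferredFrom S (ctx K (muxRel g (I.wire n) (I₁.wire n) (I₂.wire n))) := by
  have hr := hG _ (rMuxNat_mem kd)
  rcases kd with b | _ | _ | _ | _ | _ | _ <;>
    rcases args with _ | ⟨a₁, _ | ⟨a₂, _ | ⟨a₃, _ | ⟨a₄, l⟩⟩⟩⟩ <;>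
    simp only [Kind.arity, List.length_cons, List.length_nil] at hlen <;> try omega
  · exact FregeSystem.IsInferredFrom.of_rule hr
      (FregeSystem.sub [K, var g, const true, const true, const true, const true, const true, const true,
        const true, const true, const true, var (I₁.wire n), var (I₂.wire n), var (I.wire n)])
      rfl (FregeSystem.prems_cons hd (FregeSystem.prems_cons hd₁ (FregeSystem.prems_cons hd₂ FregeSystem.prems_nil)))
  · exact FregeSystem.IsInferredFrom.of_rule hr
      (FregeSystem.sub [K, var g, var (I₁.ref a₁), const true, const true, var (I₂.ref a₁), const true, const true,
        var (I.ref a₁), const true, const true, var (I₁.wire n), var (I₂.wire n), var (I.wire n)])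
      rfl (FregeSystem.prems_cons hd (FregeSystem.prems_cons hd₁ (FregeSystem.prems_cons hd₂
        (FregeSystem.prems_cons (hargs a₁ (by simp)) FregeSystem.prems_nil))))
  · exact FregeSystem.IsInferredFrom.of_rule hr
      (FregeSystem.sub [K, var g, var (I₁.ref a₁), var (I₁.ref a₂), const true, var (I₂.ref a₁), var (I₂.ref a₂), const true,
        var (I.ref a₁), var (I.ref a₂), const true, var (I₁.wire n), var (I₂.wire n), var (I.wire n)])
      rfl (FregeSystem.prems_cons hd (FregeSystem.prems_cons hd₁ (FregeSystem.prems_cons hd₂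
        (FregeSystem.prems_cons (hargs a₁ (by simp)) (FregeSystem.prems_cons (hargs a₂ (by simp)) FregeSystem.prems_nil)))))
  · exact FregeSystem.IsInferredFrom.of_rule hr
      (FregeSystem.sub [K, var g, var (I₁.ref a₁), var (I₁.ref a₂), const true, var (I₂.ref a₁), var (I₂.ref a₂), const true,
        var (I.ref a₁), var (I.ref a₂), const true, var (I₁.wire n), var (I₂.wire n), var (I.wire n)])
      rfl (FregeSystem.prems_cons hd (FregeSystem.prems_cons hd₁ (FregeSystem.prems_cons hd₂
        (FregeSystem.prems_cons (hargs a₁ (by simp)) (FregeSystem.prems_cons (hargs a₂ (by simp)) FregeSystem.prems_nil)))))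
  all_goals
    exact FregeSystem.IsInferredFrom.of_rule hr
      (FregeSystem.sub [K, var g, var (I₁.ref a₁), var (I₁.ref a₂), var (I₁.ref a₃), var (I₂.ref a₁), var (I₂.ref a₂),
        var (I₂.ref a₃), var (I.ref a₁), var (I.ref a₂), var (I.ref a₃), var (I₁.wire n), var (I₂.wire n), var (I.wire n)])
      rfl (FregeSystem.prems_cons hd (FregeSystem.prems_cons hd₁ (FregeSystem.prems_cons hd₂
        (FregeSystem.prems_cons (hargs a₁ (by simp)) (FregeSystem.prems_cons (hargs a₂ (by simp))
          (FregeSystem.prems_cons (hargs a₃ (by simp)) FregeSystem.prems_nil))))))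

/-- **Multiplexer naturality.** Let `I, I₁, I₂` be instances of a well-formed template with
available definitions whose inputs satisfy `inᵢ(I) ↔ (g ? inᵢ(I₁) : inᵢ(I₂))`. Then every wire
satisfies `wire k(I) ↔ (g ? wire k(I₁) : wire k(I₂))` (one inference per gate, in order).
[cite: CookReckhow1979, §2] -/
theorem _root_.Literature.Computability.MetaComplexity.FregeSystem.Yields.muxNat (hG : ∀ r ∈ muxNatRules, r ∈ G.rules)
    {t : Template} {nIn : ℕ} (hwf : t.WF nIn) (I I₁ I₂ : Inst) (K : PropForm ℕ) (g : ℕ)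
    (hd : I.DefsAvail t K Γ) (hd₁ : I₁.DefsAvail t K Γ) (hd₂ : I₂.DefsAvail t K Γ)
    (hin : ∀ i < nIn, ctx K (muxRel g (I.inputs.getD i 0) (I₁.inputs.getD i 0) (I₂.inputs.getD i 0)) ∈ Γ) :
    G.Yields Γ (ctxSet K ((List.range t.length).map fun k => muxRel g (I.wire k) (I₁.wire k) (I₂.wire k)))
      (t.length * (K.size + 24)) := by
  rw [ctxSet_map_range]
  refine Yields.indexed (fun k hk => Or.inr ?_) fun k _ => by simp [ctx, size]
  refine isInferredFrom_muxNat hG I I₁ I₂ K g k (t[k]).kind (t[k]).args (hwf k hk).1 (Or.inl (hd k hk))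
    (Or.inl (hd₁ k hk)) (Or.inl (hd₂ k hk)) fun a ha => ?_
  obtain ⟨h₁, h₂⟩ := (hwf k hk).2 a ha
  cases a with
  | inl i => exact Or.inl (hin i (h₁ i rfl))
  | inr j => exact Or.inr ⟨j, h₂ j rfl, rfl⟩

/-! #### Consequences of multiplexer relations -/

/-- The relation lines of three words. [folklore] -/
def muxRelW (g : ℕ) (w w₁ w₂ : ℕ → ℕ) (W : ℕ) : List (PropForm ℕ) :=
  (List.range W).map fun i => muxRel g (w i) (w₁ i) (w₂ i)

/-- Pointwise reading of `Holds` of the relation lines. [folklore] -/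
theorem holds_muxRelW_iff {K : PropForm ℕ} {g : ℕ} {w w₁ w₂ : ℕ → ℕ} {W : ℕ} :
    Holds K Γ (muxRelW g w w₁ w₂ W) ↔ ∀ i < W, ctx K (muxRel g (w i) (w₁ i) (w₂ i)) ∈ Γ := by
  simp [Holds, muxRelW]

end Netlist

namespace FregeSystem.Yields

open Netlist

variable {G : FregeSystem} {Γ : Set (PropForm ℕ)} {K : PropForm ℕ} {g : ℕ} {w w₁ w₂ d : ℕ → ℕ} {W : ℕ}

/-- **Selector true**: `w ↔ w₁` bitwise. [cite: CookReckhow1979, §2] -/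
theorem muxRelW_true (hG : ∀ r ∈ Logic.rules, r ∈ G.rules) (h : Holds K Γ (muxRelW g w w₁ w₂ W))
    (hg : ctx K (var g) ∈ Γ) : G.Yields Γ (ctxSet K (eqW w w₁ W)) (W * (K.size + 10)) :=
  ctx_range (fun i hi => Or.inr (Logic.infer hG 13 (by decide) (FregeSystem.sub [K, var (w i), var g, var (w₁ i), var (w₂ i)])
    rfl (FregeSystem.prems_cons (holds_muxRelW_iff.1 h i hi) (FregeSystem.prems_cons hg FregeSystem.prems_nil))))
    fun _ _ => (size_eqv _ _).le

/-- **Selector false**: `w ↔ w₂` bitwise. [cite: CookReckhow1979, §2] -/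
theorem muxRelW_false (hG : ∀ r ∈ Logic.rules, r ∈ G.rules) (h : Holds K Γ (muxRelW g w w₁ w₂ W))
    (hg : ctx K (neg (var g)) ∈ Γ) : G.Yields Γ (ctxSet K (eqW w w₂ W)) (W * (K.size + 10)) :=
  ctx_range (fun i hi => Or.inr (Logic.infer hG 14 (by decide) (FregeSystem.sub [K, var (w i), var g, var (w₁ i), var (w₂ i)])
    rfl (FregeSystem.prems_cons (holds_muxRelW_iff.1 h i hi) (FregeSystem.prems_cons hg FregeSystem.prems_nil))))
    fun _ _ => (size_eqv _ _).le

/-- **Equal data**: if `w₁ ↔ d` and `w₂ ↔ d` bitwise then `w ↔ d`. [cite: CookReckhow1979, §2] -/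
theorem muxRelW_both (hG : ∀ r ∈ muxNatRules, r ∈ G.rules) (h : Holds K Γ (muxRelW g w w₁ w₂ W))
    (h₁ : Holds K Γ (eqW w₁ d W)) (h₂ : Holds K Γ (eqW w₂ d W)) : G.Yields Γ (ctxSet K (eqW w d W)) (W * (K.size + 10)) :=
  ctx_range (fun i hi => Or.inr (FregeSystem.IsInferredFrom.of_rule (hG _ mem_muxNatRules.1)
    (FregeSystem.sub [K, var (w i), var g, var (w₁ i), var (w₂ i), var (d i)]) rfl
    (FregeSystem.prems_cons (holds_muxRelW_iff.1 h i hi) (FregeSystem.prems_cons (holds_eqW_iff.1 h₁ i hi)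
      (FregeSystem.prems_cons (holds_eqW_iff.1 h₂ i hi) FregeSystem.prems_nil))))) fun _ _ => (size_eqv _ _).le

/-- **Both false**: a single relation with both data bits false gives a false bit.
[cite: CookReckhow1979, §2] -/
theorem muxRel_ff (hG : ∀ r ∈ muxNatRules, r ∈ G.rules) {u u₁ u₂ : ℕ} (h : ctx K (muxRel g u u₁ u₂) ∈ Γ)
    (h₁ : ctx K (neg (var u₁)) ∈ Γ) (h₂ : ctx K (neg (var u₂)) ∈ Γ) : G.Yields Γ {ctx K (neg (var u))} (K.size + 3) := by
  have h' := single (FregeSystem.IsInferredFrom.of_rule (hG _ mem_muxNatRules.2.1) (S := Γ)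
    (FregeSystem.sub [K, var u, var g, var u₁, var u₂]) (θ := ctx K (neg (var u))) rfl
    (FregeSystem.prems_cons h (FregeSystem.prems_cons h₁ (FregeSystem.prems_cons h₂ FregeSystem.prems_nil))))
  exact h'.mono_size (by simp [ctx, size])

/-- **Both true**: a single relation with both data bits true gives a true bit.
[cite: CookReckhow1979, §2] -/
theorem muxRel_tt (hG : ∀ r ∈ muxNatRules, r ∈ G.rules) {u u₁ u₂ : ℕ} (h : ctx K (muxRel g u u₁ u₂) ∈ Γ)
    (h₁ : ctx K (var u₁) ∈ Γ) (h₂ : ctx K (var u₂) ∈ Γ) : G.Yields Γ {ctx K (var u)} (K.size + 3) := by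
  have h' := single (FregeSystem.IsInferredFrom.of_rule (hG _ mem_muxNatRules.2.2) (S := Γ)
    (FregeSystem.sub [K, var u, var g, var u₁, var u₂]) (θ := ctx K (var u)) rfl
    (FregeSystem.prems_cons h (FregeSystem.prems_cons h₁ (FregeSystem.prems_cons h₂ FregeSystem.prems_nil))))
  exact h'.mono_size (by simp [ctx, size])

end FregeSystem.Yields

end Literature.Computability.MetaComplexity
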